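import Summits.BirchSwinnertonDyer.BirchSwinnertonDyer.Theorems.CMKolyvaginAtInertTwoShaCountAtTwo
import Summits.BirchSwinnertonDyer.BirchSwinnertonDyer.Theorems.CMKolyvaginAtInertTwoFrobeniusBridgeAtTwo
import Literature.NumberTheory.EllipticCurves.TwoTorsionOddDegreeBaseChangeProofs
import HarnessLib

/-!
# Route `CMKolyvaginAtInertTwo`, crux `CMKolyvaginExactAtInertTwo` (stmt-BirchSwinnertonDyer-24277):
# THE COUNT IDENTITY `#Ш(E/K)[2^∞] = #Ш(E/ℚ)[2^∞] · #Ш(E^{(d_K)}/ℚ)[2^∞]`, V — on the habitat H₂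
# (CM, `2` inert in `F`, `ρ̄_{E,2}` onto; prime Heegner field with `q = |d_K|` inert in `F`)

Seat `bsd-line-cmk2-p1` g15 (cell `bsd-print-cf2`); helper (`--supports stmt-BirchSwinnertonDyer-24277`).
THEOREMS ONLY: no definition, no named fact, no `sorry`; Milne's Weil-restriction theorem
(`Milne1972.bsdQuotient_baseChange_quadratic_anyModel`, route item 24149 `MilneAnyModel`) stays a
HYPOTHESIS; no item is closed; BSD is not proved by this.

File IV (`…ShaCountAtTwo`) proves the count identity on "H₂-shaped" hypotheses: `Δ < 0`,
`(Δ_E/q) = −1`, no point of order `2` in `E(K)`. This file discharges those three from the crux's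
own binders: `Δ < 0` is g2's `KolyvaginEigenTwo.Δ_neg_of_cmInert_two` (CM, `CMInert W 2`, `ρ̄₂`
onto); `E(K)[2] = 0` is ty2's
`forall_two_nsmul_baseChange_of_hasSurjectiveModNGaloisRep_two_of_isImaginaryQuadratic`; and
`(Δ_E/q) = −1` follows from **`CMInert W q`** (`q` inert in the CM field `F`, the route's own
predicate for its Kolyvagin primes) because `Δ_E = d_F · s²` on H₂ (g3's
`KolyvaginFrobeniusTwo.exists_Δ_eq_cmFieldDiscr_mul_sq_of_cmInert_two`) and `q ∤ Δ_E`. What is NOT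
discharged here: `CMInert W q` itself for the ramified prime `q = |d_K|` (on H₂ it follows from the
Heegner hypothesis at the prime of `F` and quadratic reciprocity — not in the tree), `|d_K|` prime
(the item allows any odd `d_K ≠ −3`; KERNEL-STATUS §13.4 advises restricting to prime `|d_K|`),
total rank one and the finiteness of `Ш(E/ℚ)`, `Ш(E^{(d_K)}/ℚ)` (Gross–Zagier–Kolyvagin inputs of
the route), and Milne.

* `jacobiSym_num_Δ_eq_neg_one_of_cmInert` — `(Δ_E/q) = −1` for an odd good prime `q` inert in `F`;
* `card_primaryComponent_sha_two_baseChange_eq_mul_of_cmInert_of_milne` — **the count identity on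
  H₂ with prime `|d_K| = q`, `CMInert W q`**, modulo Milne, total rank one and finiteness.

References: Milne 1972 §1; Kramer 1981 Prop. 3; Gross 1991 §§2–3; Silverman *ATAEC* App. A §3.
-/

-- single-conjunct summit: `Summit.BirchSwinnertonDyer.BirchSwinnertonDyer.…` repeats the name by design
set_option linter.dupNamespace false
set_option autoImplicit false

noncomputable section

open scoped Classical

open WeierstrassCurve NumberField Literature.NumberTheory.EllipticCurves
  Literature.NumberTheory.EllipticCurves.Rank1Residual Literature.NumberTheory.QuadraticFields
  Summit.BirchSwinnertonDyer.Rank1Residual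

namespace Summit.BirchSwinnertonDyer.BirchSwinnertonDyer.Theorems.ShaCountTwo

/-! ## §1 `(Δ_E/q) = −1` at an odd good prime inert in the CM field -/

/-- **`(Δ_E/q) = −1` for an odd prime `q` of good reduction that is INERT in the CM field `F`**, on
H₂ (`W/ℚ` globally minimal with CM, `2` inert in `F`, `ρ̄_{E,2}` onto): `Δ_E = d_F·s²` with
`s ∈ ℚ` (g3's `exists_Δ_eq_cmFieldDiscr_mul_sq_of_cmInert_two`), `d_F` is a non-square mod `q`
(`CMInert W q`, `not_isSquare_cmFieldDiscr_of_cmInert`), and `q ∤ Δ_E` (good reduction,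
`not_dvd_minimalDiscriminantInt_of_hasGoodReductionAtPrime'`), so `Δ_E` is a non-zero non-square
mod `q`; `jacobiSym = legendreSym` at a prime. (`W.Δ.num = Δ_min` for a globally minimal `W`.)
[cite: SilvermanATAEC1994, App. A §3 (table of CM j-invariants)] [cite: Kramer1981, Prop. 3] -/
theorem jacobiSym_num_Δ_eq_neg_one_of_cmInert (W : WeierstrassCurve ℚ) [W.IsElliptic]
    [W.IsGloballyMinimal] (hCM : W.HasCM) (hin : CMInert W 2) (hsurj : W.HasSurjectiveModNGaloisRep 2)
    {q : ℕ} [Fact q.Prime] (hq2 : q ≠ 2) (hinq : CMInert W q) (hgood : W.HasGoodReductionAtPrime q) :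
    jacobiSym W.Δ.num q = -1 := by
  have hqP : q.Prime := Fact.out
  obtain ⟨-, s, hs⟩ := KolyvaginFrobeniusTwo.exists_Δ_eq_cmFieldDiscr_mul_sq_of_cmInert_two W hCM hin hsurj
  set d : ℤ := cmFieldDiscrOfJ W.j with hd_def
  have hns : ¬ IsSquare ((d : ℤ) : ZMod q) :=
    KolyvaginFrobeniusTwo.not_isSquare_cmFieldDiscr_of_cmInert W hq2 hinq
  have hqd : ¬ (q : ℤ) ∣ d := hinq.1
  set Δm : ℤ := minimalDiscriminantInt W with hΔm_def
  have hcast : (Δm : ℚ) = W.Δ := cast_minimalDiscriminantInt W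
  have hnum : W.Δ.num = Δm := by rw [← hcast, Rat.num_intCast]
  have hqΔ : ¬ (q : ℤ) ∣ Δm := not_dvd_minimalDiscriminantInt_of_hasGoodReductionAtPrime' W q hgood
  -- clear denominators: `Δ_min · den(s)² = d_F · num(s)²`
  have hden0 : (s.den : ℚ) ≠ 0 := by exact_mod_cast s.den_nz
  have hsq : (Δm : ℚ) * (s.den : ℚ) ^ 2 = (d : ℚ) * (s.num : ℚ) ^ 2 := by
    have h1 : (s.num : ℚ) = s * s.den := (Rat.mul_den_eq_num s).symm
    rw [hcast, hs, h1]
    ring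
  have hZ : Δm * (s.den : ℤ) ^ 2 = d * s.num ^ 2 := by exact_mod_cast hsq
  have hmod : (Δm : ZMod q) * ((s.den : ℤ) : ZMod q) ^ 2 = (d : ZMod q) * ((s.num : ℤ) : ZMod q) ^ 2 := by
    have := congrArg (Int.cast : ℤ → ZMod q) hZ
    push_cast at this ⊢
    exact this
  have hΔ0 : ((Δm : ℤ) : ZMod q) ≠ 0 := by
    rw [Ne, ZMod.intCast_zmod_eq_zero_iff_dvd]; exact hqΔ
  have hd0 : ((d : ℤ) : ZMod q) ≠ 0 := by
    rw [Ne, ZMod.intCast_zmod_eq_zero_iff_dvd]; exact hqd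
  -- `den(s)` and `num(s)` are units mod `q`
  have hden : ((s.den : ℤ) : ZMod q) ≠ 0 := by
    intro h0
    have hqden : (q : ℤ) ∣ (s.den : ℤ) := (ZMod.intCast_zmod_eq_zero_iff_dvd _ _).mp h0
    have h2 : (d : ZMod q) * ((s.num : ℤ) : ZMod q) ^ 2 = 0 := by
      rw [← hmod, h0]; ring
    rcases mul_eq_zero.mp h2 with h | h
    · exact hd0 h
    · have hnum0 : ((s.num : ℤ) : ZMod q) = 0 := pow_eq_zero_iff (two_ne_zero) |>.mp h
      have hqnum : (q : ℤ) ∣ s.num := (ZMod.intCast_zmod_eq_zero_iff_dvd _ _).mp hnum0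
      have hqnum' : q ∣ s.num.natAbs := Int.natCast_dvd.mp hqnum
      have hqden' : q ∣ s.den := by exact_mod_cast hqden
      have h1 : q ∣ Nat.gcd s.num.natAbs s.den := Nat.dvd_gcd hqnum' hqden'
      rw [s.reduced.gcd_eq_one] at h1
      exact hqP.one_lt.ne' (Nat.dvd_one.mp h1)
  have hnum0 : ((s.num : ℤ) : ZMod q) ≠ 0 := by
    intro h0
    have : (Δm : ZMod q) * ((s.den : ℤ) : ZMod q) ^ 2 = 0 := by rw [hmod, h0]; ring
    rcases mul_eq_zero.mp this with h | h
    · exact hΔ0 h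
    · exact hden (pow_eq_zero_iff two_ne_zero |>.mp h)
  -- `Δ_min` is a non-square mod `q`
  have hnsΔ : ¬ IsSquare ((Δm : ℤ) : ZMod q) := by
    rintro ⟨r, hr⟩
    apply hns
    refine ⟨r * ((s.den : ℤ) : ZMod q) * (((s.num : ℤ) : ZMod q))⁻¹, ?_⟩
    have key : (d : ZMod q) = (Δm : ZMod q) * ((s.den : ℤ) : ZMod q) ^ 2 *
        ((((s.num : ℤ) : ZMod q)) ^ 2)⁻¹ := by
      rw [hmod, mul_assoc, mul_inv_cancel₀ (pow_ne_zero 2 hnum0), mul_one]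
    rw [key, hr]
    field_simp
  rw [hnum, ← jacobiSym.legendreSym.to_jacobiSym, legendreSym.eq_neg_one_iff]
  exact hnsΔ

/-! ## §2 The count identity on H₂ (prime Heegner field, `q = |d_K|` inert in `F`) -/

/-- **THE COUNT IDENTITY ON THE HABITAT H₂ (modulo Milne, total rank one and finiteness).** Let
`W/ℚ` be globally minimal with CM, `2` inert in the CM field `F` (`CMInert W 2`), `ρ̄_{E,2}` onto
`GL₂(𝔽₂)`; `K` imaginary quadratic with `d_K` odd and `q = |d_K|` PRIME and inert in `F`
(`CMInert W q`), satisfying the Heegner hypothesis for the conductor of `W`; `Wd = Cd • W^{(d_K)}`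
a globally minimal model of the twist with `|u| = 1`; `rank E(ℚ) + rank Wd(ℚ) = 1`; `Ш(E/ℚ)` and
`Ш(Wd/ℚ)` finite. THEN `Ш(E_K)` is finite and
**`#Ш(E_K)[2^∞] = #Ш(E/ℚ)[2^∞] · #Ш(Wd/ℚ)[2^∞]`**. Inputs discharged here: `Δ < 0`
(`KolyvaginEigenTwo.Δ_neg_of_cmInert_two`), `E(K)[2] = 0`
(`forall_two_nsmul_baseChange_of_hasSurjectiveModNGaloisRep_two_of_isImaginaryQuadratic`),
`(Δ/q) = −1` (`jacobiSym_num_Δ_eq_neg_one_of_cmInert`, with `W` good at the ramified `q ∤ N`).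
[cite: Milne1972ArithmeticAV, §1 Thm. 1 and §2 (through DokchitserDokchitserAnnals2010, §2.1, proof of Thm. 2.3)]
[cite: Kramer1981, Prop. 3] [cite: GrossLMS1991, §2] -/
theorem card_primaryComponent_sha_two_baseChange_eq_mul_of_cmInert_of_milne
    (hMilneC : Milne1972.bsdQuotient_baseChange_quadratic_anyModel)
    (W : WeierstrassCurve ℚ) [W.IsElliptic] [W.IsGloballyMinimal]
    (hCM : W.HasCM) (hin : CMInert W 2) (hsurj : W.HasSurjectiveModNGaloisRep 2)
    (K : Type) [Field K] [NumberField K] (hK : IsImaginaryQuadratic K)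
    (hodd : Odd (NumberField.discr K)) (hH : SatisfiesHeegnerHypothesis (W.conductorNorm ℤ) K)
    (hq : (NumberField.discr K).natAbs.Prime) (hinq : CMInert W (NumberField.discr K).natAbs)
    (Wd : WeierstrassCurve ℚ) [Wd.IsElliptic] [Wd.IsGloballyMinimal] (Cd : VariableChange ℚ)
    (hWd : Cd • W.quadraticTwist (NumberField.discr K : ℚ) = Wd) (hu : |(Cd.u : ℚ)| = 1)
    (hr : W.mordellWeilRank + Wd.mordellWeilRank = 1) [Finite W.sha] [Finite Wd.sha] :
    Finite (W.baseChange K).sha ∧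
      Nat.card (AddCommGroup.primaryComponent (W.baseChange K).sha 2) =
        Nat.card (AddCommGroup.primaryComponent W.sha 2) *
          Nat.card (AddCommGroup.primaryComponent Wd.sha 2) := by
  set q : ℕ := (NumberField.discr K).natAbs with hq_def
  haveI : Fact q.Prime := ⟨hq⟩
  have hΔ : W.Δ < 0 := KolyvaginEigenTwo.Δ_neg_of_cmInert_two W hCM hin hsurj
  have h2t : ∀ P : (W.baseChange K).toAffine.Point, (2 : ℕ) • P = 0 → P = 0 :=
    forall_two_nsmul_baseChange_of_hasSurjectiveModNGaloisRep_two_of_isImaginaryQuadratic W hsurj K hK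
  -- the ramified prime `q`: odd, `q ∤ N` (it does not split), `W` good at `q`
  have hqd : (q : ℤ) ∣ NumberField.discr K := by
    rw [hq_def]; exact Int.natAbs_dvd.mpr (dvd_refl _)
  have hq2 : q ≠ 2 := by
    intro h
    obtain ⟨m, hm⟩ := hodd
    have h2 : (2 : ℤ) ∣ NumberField.discr K := by
      have := hqd
      rw [h] at this
      exact_mod_cast this
    omega
  have hqN : ¬ q ∣ W.conductorNorm ℤ := by
    intro hqN
    refine not_dvd_discr_of_split hK hq hq2 (fun p hp hpq => ?_) hqd
    rw [(Nat.prime_dvd_prime_iff_eq hp hq).mp hpq]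
    exact hH q hq hqN
  have hgood : W.HasGoodReductionAtPrime q := by
    by_contra h
    exact hqN ((W.dvd_conductorNorm_iff_not_hasGoodReductionAtPrime q).mpr h)
  have hjac : jacobiSym W.Δ.num q = -1 :=
    jacobiSym_num_Δ_eq_neg_one_of_cmInert W hCM hin hsurj hq2 hinq hgood
  exact card_primaryComponent_sha_two_baseChange_eq_mul_of_milne W K hK hodd hH hΔ Wd Cd hWd hu hr h2t
    hMilneC hq hjac

end Summit.BirchSwinnertonDyer.BirchSwinnertonDyer.Theorems.ShaCountTwo

end
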